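import Literature.MathematicalPhysics.QuantumFieldTheory.BalabanImbrieJaffe1984to88.BIJ88Sect4Statements
import Literature.MathematicalPhysics.QuantumFieldTheory.BalabanImbrieJaffe1984to88.BIJ88Sect2Statements
import Literature.MathematicalPhysics.QuantumFieldTheory.BalabanImbrieJaffe1984to88.BIJ88Sect5Statements

/-!
# `BalabanImbrieJaffe1984to88.BIJ88Sect5StatementsPart3` — T. Bałaban, J. Imbrie, A. Jaffe, *Effective action and cluster
properties of the abelian Higgs model*, Commun. Math. Phys. **114** (1988) 257–315 [BalabanImbrieJaffe1988]: Sect. 5, part 3 —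
the BACKGROUND-FIELD THREAD of the inductive step on the carriers of Sects. 2–4: the partition of unity (5.2.1) and the
characteristic functions (5.2.2), the small field region `Λ₀^{(k)}` and the resummation (5.2.6)–(5.2.7) (p. 279), the restricted
block field gauge invariance (5.2.9), the first translation (5.3.1)/(5.3.4), the gauge transformation (5.4.1)–(5.4.6), (5.4.9),
the second translation (5.5.1), (5.5.2), (5.5.4), (5.5.7), (5.5.11), (5.5.13)–(5.5.14), the cutoff `θ_k` and the new background
field (5.6.1), the product formulas (5.6.5), (5.6.6), (5.7.1)

statement-level skeleton of published theorems with citation tags; proofs where landed; nothing here is a claim about the Yang–Mills mass gap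

PDF held: `paper:balaban1988-cmp114-bij-abelian-higgs-effective-action` (journal page = PDF page + 256; the PDF is an
OFFLOADED store file, restored with `lit pull papers/<key>/original.pdf`).  Renders read as images: PDF pp. 21–33, 35–36,
40–41, 44–45, 52 (journal 277–289, 291–292, 296–297, 300–301, 308), CCITT-G4 → PNG ×2 with
`run/shared/lean/pub/pub-balaban/b2b-balaban-ref1/tools/g4png.py` (copies: the r16 seat folder `scratch/c2pages/`).

CITATION HEADER (lean-in-tree rule).  Part of the lit-balaban TYPED SKELETON (HOME `run/shared/lean/pub/lit-balaban/`; rows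
`C2.Eq5.2.1-5.2.4`, `C2.Eq5.2.6-5.2.8`, `C2.Eq5.2.9`, `C2.Eq5.3.1-5.3.7`, `C2.Eq5.4.1-5.4.6`, `C2.Eq5.4.8-5.4.10`, `C2.Eq5.5.1-5.5.12`,
`C2.Eq5.5.13-5.5.14`, `C2.Eq5.6.1-5.6.2`, `C2.Claim@286`, `C2.Eq5.6.6-5.6.12`, `C2.Eq5.7.1-5.7.4` of
`HOME/lit-balaban-r16/ROWS-C2-part2.md`; companion of `BIJ88Sect5Statements` (definitions + proved identities, part 1) and
`BIJ88Sect5StatementsPart2` (the stated bounds as `Prop` leaves); unit `lit-balaban-r16`, reader of C2 Sect. 5).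
WHAT IS REPRODUCED, and how.  (a) DEFINITIONS WITH BODIES on the tori of `Balaban1983to89.Setup` and the U(1)/cutoff carriers of
`BIJ88Sect3Statements`/`BIJ88Sect4Statements`/`BIJ88Sect5Statements`: the four characteristic functions (5.2.2) (AS PRINTED —
see the TRANSCRIPTION NOTE at `chiX`), the small field region `Λ₀^{(k)}` of p. 279 (over an abstract partition of the unit lattice
into `r(e_k)`-cubes), the five maps of (5.2.9) (they ARE `BIJ88Sect4Statements.bgGaugePhi/bgGaugeU/blockGaugeUj` at the printed
parameters), the translation (5.3.1), the exponential background form `(Q^{s*}_{k+1}v) exp ie_kη[X]` shared by (5.3.4), (5.4.2),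
(5.4.6), (5.4.10), (5.5.13)–(5.5.14), (5.6.1) with the printed brackets, the cutoff `θ_k` (its two printed support clauses), the
translation (5.5.2); IN A RING OF OPERATORS (the style of `BIJ88Sect2Statements` for (2.9)–(2.22); lattice superscripts `η`, `L^jη`
suppressed): the kernels `w′₁` (5.4.3), `w₁` (5.4.4), `w₂` (5.4.7), `w₅` (5.4.9), `w′₃`, `w″₃` (5.5.4), `w‴₃` (5.5.7).
(b) PROVED: the partition of unity (5.2.1) (a finite product identity); the resummation (5.2.6)–(5.2.7) over the small field
regions (fibrewise regrouping of (5.2.1), the region map abstract); the invariance of `χ_x`, `χ_b`, `χ_p` under (5.2.9) asserted on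
p. 279; the ring identities (5.4.3), (5.4.4), the second equality of (5.4.9) and (5.6.5) FROM (5.4.1) = (2.20)
(`BIJ88Sect2Statements.Eq220`) — with the first term of `w₅` carrying the sign `(𝒟_k − 𝒟_{k,loc})` forced by (5.4.1), the
printed `(𝒟_{k,loc} − 𝒟_k)` being refuted in a commutative instance (`eq549_asPrinted_false`; TRANSCRIPTION NOTE at `w5`); the
passage (5.4.2) → (5.4.6) under the background gauge transformation (5.4.5); (5.5.4), (5.5.7) with the remainders DEFINED as
remainders; (5.5.11) as the recursion step of (2.12); the bracket computation (5.5.13) → (5.5.14) from (5.5.2), (5.5.11); the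
product formulas (5.6.6)/(5.7.1) `ũ_{k+1}ũ = u′_k` and the reduction of (5.6.1) to the form (4.2) where `θ_k = 1`.
(c) STATEMENTS as `def … : Prop`: the smallness clauses of p. 280 (`|A′_b| ≦ cp(e_k)`, `|f(p)| ≦ cp(e_k)`), (5.5.1), the two support
clauses of `θ_k` (p. 285), the restricted invariance (5.2.9) of a function of the fields.  NOT typed (rows stay `absent` at the
reader level, reasons in ROWS-C2-part2.md): the densities (5.2.8)/(5.9.6), the δ-function identities (5.3.6)–(5.3.7), the quadratic
forms `𝒬_i` (5.3.5), (5.5.3), (5.5.6), (5.5.8)–(5.5.9), (5.5.12), the geometric splitting (5.3.2), the approximation (5.5.10) (printed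
with `≈`).  NOTHING of the paper is asserted beyond the kernel-checked items under (b).  Unit `lit-balaban-r16` (gen 2).
-/

namespace Literature.MathematicalPhysics.QuantumFieldTheory.BalabanImbrieJaffe1984to88.BIJ88Sect5StatementsPart3

open Literature.MathematicalPhysics.QuantumFieldTheory.Balaban1983to89
open BIJ88Sect3Statements BIJ88Sect4Statements BIJ88Sect5Statements
open scoped BigOperators
open Complex

noncomputable section

/-! ## (5.2.1): the partition of unity -/

/-- kernel: for one species of "points" `S` with characteristic functions `χ` (and `χ^c = 1 − χ`):
`Σ_{P ⊂ S} Π_{x∈P} χ^c_x Π_{x∈S∖P} χ_x = Π_{x∈S} (χ^c_x + χ_x) = 1` — the mechanism of (5.2.1). [cite: BalabanImbrieJaffe1988, (5.2.1) p.278] -/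
theorem sum_powerset_prod_compl_mul_prod {ι : Type*} [DecidableEq ι] (S : Finset ι) (χ : ι → ℝ) :
    ∑ T ∈ S.powerset, (∏ x ∈ T, (1 - χ x)) * ∏ x ∈ S \ T, χ x = 1 := by
  rw [← Finset.prod_add]
  simp

/-- **(5.2.1)** p. 278 [PDF 22], verbatim: *"5.2. Restrictions on the Fields. We insert a partition of unity under the integrals:
1 = Σ_{P_x⊂Λ₁₃^{(k−1)′}} Σ_{P_y⊂Λ₁₃^{(k−1)″}} Σ_{P_b⊂Λ₁₃^{(k−1)′*}} Σ_{P_p⊂Λ₁₃^{(k−1)′**}} × Π_{x∈P_x} χ^c_x Π_{x∈Λ₁₃^{(k−1)′}∖P_x} χ_x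
Π_{y∈P_y} χ^c_y Π_{y∈Λ₁₃^{(k−1)″}∖P_y} χ_y × Π_{b∈P_b} χ^c_b Π_{b∈Λ₁₃^{(k−1)′*}∖P_b} χ_b Π_{p∈P_p} χ^c_p Π_{p∈Λ₁₃^{(k−1)′**}∖P_p} χ_p,
(5.2.1)"* with *"χ^c = 1 − χ"* ((5.2.2)) — PROVED for four arbitrary finite index sets (sites `x`, block sites `y`, bonds `b`,
plaquettes `p`) and arbitrary real functions `χ_x, χ_y, χ_b, χ_p`. [cite: BalabanImbrieJaffe1988, (5.2.1) p.278] -/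
theorem eq521 {ιx ιy ιb ιp : Type*} [DecidableEq ιx] [DecidableEq ιy] [DecidableEq ιb] [DecidableEq ιp]
    (Sx : Finset ιx) (Sy : Finset ιy) (Sb : Finset ιb) (Sp : Finset ιp)
    (χx : ιx → ℝ) (χy : ιy → ℝ) (χb : ιb → ℝ) (χp : ιp → ℝ) :
    ∑ Px ∈ Sx.powerset, ∑ Py ∈ Sy.powerset, ∑ Pb ∈ Sb.powerset, ∑ Pp ∈ Sp.powerset,
      ((∏ x ∈ Px, (1 - χx x)) * ∏ x ∈ Sx \ Px, χx x) * (((∏ y ∈ Py, (1 - χy y)) * ∏ y ∈ Sy \ Py, χy y) *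
      (((∏ b ∈ Pb, (1 - χb b)) * ∏ b ∈ Sb \ Pb, χb b) * ((∏ p ∈ Pp, (1 - χp p)) * ∏ p ∈ Sp \ Pp, χp p))) = 1 := by
  simp only [← Finset.mul_sum, sum_powerset_prod_compl_mul_prod, mul_one]

/-! ## (5.2.2): the characteristic functions `χ_x, χ_y, χ_b, χ_p` -/

variable {P : Params} {j : ℕ}

/-- **(5.2.2)** p. 278 [PDF 22], the site factor, verbatim: *"χ_x = χ(λ_kp(e_k), |φ(x)|), if (L^kε)^d < λ; χ((L^kε)^{−1}p(e_k),
||φ| − (8λ)^{−1/2}(L^kε)^{(d−2)/2}|), if (L^kε)^d ≧ λ; = 1 − χ^c_x"* — with `χ(p, ·)` = `BIJ88Sect5Statements.cutoff` ((5.2.3)–(5.2.4)),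
`s = L^kε`, `lamk = λ_k`, `pek = p(e_k)`, applied to the value `φx = φ(x)`.  TRANSCRIPTION NOTE (recorded, not adjudicated): the first
radius is printed `λ_kp(e_k)`; the restrictions it is meant to enforce, (4.5) p. 274 and (5.9.2) p. 296, read `cλ_k^{−1/4}p(e_k)`;
typed AS PRINTED with `lamk` a free parameter, so a consumer may instantiate it with `λ_k^{−1/4}`. [cite: BalabanImbrieJaffe1988, (5.2.2) p.278] -/
def chiX (χ : CutoffProfile) (lamk pek s lam : ℝ) (d : ℕ) (φx : ℂ) : ℝ :=
  if s ^ d < lam then cutoff χ (lamk * pek) ‖φx‖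
  else cutoff χ (s⁻¹ * pek) (‖φx‖ - (8 * lam) ^ (-(1 / 2 : ℝ)) * s ^ (((d : ℝ) - 2) / 2))

/-- **(5.2.2)**, the block-site factor, verbatim: *"χ_y = χ(p(e_k), |(ψ − Q(u_k)φ)(y)|) = 1 − χ^c_y"* — on the values `ψ(y)` and
`(Q(u_k)φ)(y)` (the covariant block average entering as data, as in `BIJ88Sect3Statements.SmallField315`).
[cite: BalabanImbrieJaffe1988, (5.2.2) p.278] -/
def chiY (χ : CutoffProfile) (pek : ℝ) (ψy Qφy : ℂ) : ℝ :=
  cutoff χ pek ‖ψy - Qφy‖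

/-- **(5.2.2)**, the bond factor, verbatim: *"χ_b = χ(p(e_k), |(D_{ū_k}φ)(b)|) = 1 − χ^c_b"* — `D_{ū_k}` = `BIJ88Sect3Statements.covD 1 ū`
on the unit lattice (the bond products `ū_k` of (4.4)). [cite: BalabanImbrieJaffe1988, (5.2.2) p.278] -/
def chiB (χ : CutoffProfile) (pek : ℝ) (ubar : PBond P j → ℂ) (φ : Balaban1983to89.Site P j → ℂ) (b : PBond P j) : ℝ :=
  cutoff χ pek ‖covD 1 ubar φ b‖

/-- **(5.2.2)**, the plaquette factor, verbatim: *"χ_p = χ(e_kp(e_k), |u(p) − 1|) = 1 − χ^c_p"* — on the plaquette variable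
`u(p)` (`BIJ88Sect3Statements.plaqVar u p`). [cite: BalabanImbrieJaffe1988, (5.2.2) p.278] -/
def chiP (χ : CutoffProfile) (ek pek : ℝ) (up : ℂ) : ℝ :=
  cutoff χ (ek * pek) ‖up - 1‖

/-- kernel: `χ_x` depends on `φ(x)` only through `|φ(x)|` — it is invariant under a phase rotation of `φ(x)` (p. 279: *"it is
easily seen that the characteristic functions we have inserted are invariant"* under (5.2.9)). [cite: BalabanImbrieJaffe1988, (5.2.2) p.278] -/
theorem chiX_mul_phase (χ : CutoffProfile) (lamk pek s lam : ℝ) (d : ℕ) (φx : ℂ) (t : ℝ) :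
    chiX χ lamk pek s lam d (φx * exp (I * t)) = chiX χ lamk pek s lam d φx := by
  have h : ‖φx * exp (I * t)‖ = ‖φx‖ := by
    rw [norm_mul, mul_comm I, norm_exp_ofReal_mul_I, mul_one]
  simp only [chiX, h]

/-- kernel: `χ_b` is invariant under a unit-lattice gauge transformation of `(ū, φ)` (covariance of `D_ū`,
`BIJ88Sect3Statements.covD_gauge`). [cite: BalabanImbrieJaffe1988, (5.2.2) p.278] -/
theorem chiB_gauge (χ : CutoffProfile) (pek : ℝ) (mu : Balaban1983to89.Site P j → ℝ) (ubar : PBond P j → ℂ)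
    (φ : Balaban1983to89.Site P j → ℂ) (b : PBond P j) :
    chiB χ pek (gaugeU mu ubar) (gaugePhi mu φ) b = chiB χ pek ubar φ b := by
  have h : ‖exp ((mu b.src : ℂ) * I)‖ = 1 := by
    rw [mul_comm]; exact norm_exp_I_mul_ofReal _
  simp only [chiB, covD_gauge, norm_mul, h, one_mul]

/-- kernel: `χ_p` is invariant under a gauge transformation of `u` (`BIJ88Sect3Statements.plaqVar_gauge`).
[cite: BalabanImbrieJaffe1988, (5.2.2) p.278] -/
theorem chiP_gauge (χ : CutoffProfile) (ek pek : ℝ) (mu : Balaban1983to89.Site P j → ℝ) (u : PBond P j → ℂ) (p : Plaq P j) :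
    chiP χ ek pek (plaqVar (gaugeU mu u) p) = chiP χ ek pek (plaqVar u p) := by
  rw [plaqVar_gauge]

/-! ## p. 279: the small field region `Λ₀^{(k)}` and the resummation (5.2.6)–(5.2.7) -/

/-- The four corners `x, x+e_μ, x+e_ν, x+e_μ+e_ν` of a plaquette (the "points in" a plaquette of p. 279).
[cite: BalabanImbrieJaffe1988, (5.2.6) p.279] -/
def plaqCorners (p : Plaq P j) : Finset (Balaban1983to89.Site P j) :=
  {p.src, p.src.shift p.μ, p.src.shift p.ν, (p.src.shift p.μ).shift p.ν}

open Classical in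
/-- **p. 279** [PDF 23], verbatim: *"We define the small field region Λ₀^{(k)} as the union of r(e_k)-blocks, none of whose points
are in Λ₁₃^{(k−1)c}, P_x, or in bonds, plaquettes, or blocks in P_b, P_p, P_y. The regions Λ_α^{(k)}, 0 ≦ α ≦ 8 are thus
determined."* — on the unit lattice `T₁^{(k)}` (torus level `j`): `cube x` = the label of the `r(e_k)`-block containing `x` (an
abstract partition), `Λ13` = `Λ₁₃^{(k−1)′}` (unit-lattice sites), `Px ⊂ Λ13`, `Py` block sites (level `j+1`, their blocks
`Balaban1983to89.block y`), `Pb` bonds, `Pp` plaquettes; the region is returned as its set of sites.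
[cite: BalabanImbrieJaffe1988, (5.2.6) p.279] -/
def smallFieldRegion {γ : Type*} (cube : Balaban1983to89.Site P j → γ) (Λ13 Px : Finset (Balaban1983to89.Site P j))
    (Py : Finset (Balaban1983to89.Site P (j + 1))) (Pb : Finset (PBond P j)) (Pp : Finset (Plaq P j)) :
    Finset (Balaban1983to89.Site P j) :=
  Finset.univ.filter fun x => ∀ x' : Balaban1983to89.Site P j, cube x' = cube x →
    x' ∈ Λ13 ∧ x' ∉ Px ∧ (∀ y ∈ Py, x' ∉ block y) ∧ (∀ b ∈ Pb, x' ≠ b.src ∧ x' ≠ b.tgt) ∧ ∀ p ∈ Pp, x' ∉ plaqCorners p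

/-- kernel: `Λ₀^{(k)} ⊂ Λ₁₃^{(k−1)′}` (none of its points is in `Λ₁₃^{(k−1)c}`). [cite: BalabanImbrieJaffe1988, (5.2.6) p.279] -/
theorem smallFieldRegion_subset {γ : Type*} (cube : Balaban1983to89.Site P j → γ) (Λ13 Px : Finset (Balaban1983to89.Site P j))
    (Py : Finset (Balaban1983to89.Site P (j + 1))) (Pb : Finset (PBond P j)) (Pp : Finset (Plaq P j)) :
    smallFieldRegion cube Λ13 Px Py Pb Pp ⊆ Λ13 := by
  classical
  intro x hx
  simp only [smallFieldRegion, Finset.mem_filter, Finset.mem_univ, true_and] at hx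
  exact (hx x rfl).1

/-- kernel: `Λ₀^{(k)}` does not meet `P_x`. [cite: BalabanImbrieJaffe1988, (5.2.6) p.279] -/
theorem disjoint_smallFieldRegion {γ : Type*} (cube : Balaban1983to89.Site P j → γ) (Λ13 Px : Finset (Balaban1983to89.Site P j))
    (Py : Finset (Balaban1983to89.Site P (j + 1))) (Pb : Finset (PBond P j)) (Pp : Finset (Plaq P j)) :
    Disjoint (smallFieldRegion cube Λ13 Px Py Pb Pp) Px := by
  classical
  rw [Finset.disjoint_left]
  intro x hx
  simp only [smallFieldRegion, Finset.mem_filter, Finset.mem_univ, true_and] at hx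
  exact (hx x rfl).2.1

/-- kernel: `Λ₀^{(k)}` is a union of whole `r(e_k)`-blocks. [cite: BalabanImbrieJaffe1988, (5.2.6) p.279] -/
theorem mem_smallFieldRegion_of_cube_eq {γ : Type*} (cube : Balaban1983to89.Site P j → γ)
    (Λ13 Px : Finset (Balaban1983to89.Site P j)) (Py : Finset (Balaban1983to89.Site P (j + 1))) (Pb : Finset (PBond P j))
    (Pp : Finset (Plaq P j)) {x x' : Balaban1983to89.Site P j} (hx : x ∈ smallFieldRegion cube Λ13 Px Py Pb Pp)
    (h : cube x' = cube x) : x' ∈ smallFieldRegion cube Λ13 Px Py Pb Pp := by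
  classical
  simp only [smallFieldRegion, Finset.mem_filter, Finset.mem_univ, true_and] at hx ⊢
  intro x'' hx''
  exact hx x'' (hx''.trans h)

/-- **(5.2.7)** p. 279 [PDF 23], the weight of a small field region, verbatim: *"ζ_{Λ₀^{(k)c}} = Σ_{P_x,P_y,P_b,P_p} Π_{x∈P_x} χ^c_x
Π_{x∈Λ₁₃^{(k−1)′}∖P_x∖Λ₀^{(k)}} χ_x ⋯ Π_{p∈P_p} χ^c_p Π_{p∈Λ₁₃^{(k−1)′**}∖P_p∖Λ₀^{(k)**}} χ_p … Here the sum is over subsets compatible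
with Λ₀^{(k)c}, Λ₁₃^{(k−1)}."* — schematic typing (ref-1 F6): ONE finite index set `S` carries the four species of points of
Λ₁₃^{(k−1)} (sites, block sites, bonds, plaquettes), `P ⊂ S` the large-field set, `R P ⊂ S ∖ P` the set of points lying in the
small field region determined by `P` (the region map of p. 279, abstract), "compatible" = `R P = Λ₀`.
[cite: BalabanImbrieJaffe1988, (5.2.7) p.279] -/
def zeta527 {ι : Type*} [DecidableEq ι] (S : Finset ι) (χ : ι → ℝ) (R : Finset ι → Finset ι) (Λ₀ : Finset ι) : ℝ :=
  ∑ T ∈ S.powerset.filter (fun T => R T = Λ₀), (∏ x ∈ T, (1 - χ x)) * ∏ x ∈ (S \ T) \ Λ₀, χ x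

/-- **(5.2.7)**, the small-field characteristic function, verbatim: *"χ_{Λ₀^{(k)}} = Π_{x∈Λ₀^{(k)}} χ_x ⋯ Π_{p∈Λ₀^{(k)**}} χ_p"*.
[cite: BalabanImbrieJaffe1988, (5.2.7) p.279] -/
def chi527 {ι : Type*} (χ : ι → ℝ) (Λ₀ : Finset ι) : ℝ :=
  ∏ x ∈ Λ₀, χ x

/-- **(5.2.6)** p. 279 [PDF 23], verbatim: *"We resum the partition of unity to obtain 1 = Σ_{Λ₀^{(k)}} ζ_{Λ₀^{(k)c}} χ_{Λ₀^{(k)}},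
(5.2.6)"* — PROVED: the fibrewise regrouping of (5.2.1) over the region map `R` (any map with `R P ⊂ S ∖ P`), the sum running over
the regions that occur. [cite: BalabanImbrieJaffe1988, (5.2.6) p.279] -/
theorem eq526 {ι : Type*} [DecidableEq ι] (S : Finset ι) (χ : ι → ℝ) (R : Finset ι → Finset ι)
    (hR : ∀ T ∈ S.powerset, R T ⊆ S \ T) :
    ∑ Λ₀ ∈ S.powerset.image R, zeta527 S χ R Λ₀ * chi527 χ Λ₀ = 1 := by
  rw [← sum_powerset_prod_compl_mul_prod S χ,
    ← Finset.sum_fiberwise_of_maps_to (s := S.powerset) (t := S.powerset.image R) (g := R)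
      (fun T hT => Finset.mem_image_of_mem R hT)]
  refine Finset.sum_congr rfl fun Λ₀ _ => ?_
  rw [zeta527, chi527, Finset.sum_mul]
  refine Finset.sum_congr rfl fun T hT => ?_
  obtain ⟨hTS, hRT⟩ := Finset.mem_filter.mp hT
  have hsub : Λ₀ ⊆ S \ T := hRT ▸ hR T hTS
  rw [mul_assoc, Finset.prod_sdiff hsub]

/-! ## (5.2.9): the restricted block field gauge invariance -/

/-- **(5.2.9)** p. 279 [PDF 23], verbatim: *"Let us remark that having imposed the axial gauge conditions, we resign from all but
the following restricted block field gauge invariance: ψ_y → ψ_y e^{ie_kλ(y)}, φ_x → φ_x e^{ie_k(Q′*λ)(x)}, v_{b′} → v_{b′}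
e^{−ie_kL(∂^Lλ)(b′)}, u_b → u_b e^{−ie_k(∂Q′*λ)(b)}, u_b^{(j)} → u_b^{(j)} exp(−ie_kL^jη(∂^{L^jη}Q′*_{k−j+1}λ)(b)), b ∈ Λ₁^{(j)*c} only.
(5.2.9) … This restricted gauge invariance we intend to preserve in all subsequent operations."* — invariance of a function `F`
of the fields `(ψ, φ, v, u, {u^{(j)}})`, `λ` a real function on the block lattice `T_L^{(k+1)}` (torus level `k+1`), `ψ`, `v` at
level `k+1`, `φ`, `u` on the unit lattice (level `k`), `u^{(j)}` at level `i` (all levels carried); the maps ARE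
`BIJ88Sect4Statements.bgGaugePhi e_k`, `bgGaugeU e_k L` (`∂^L` = `LatticeFieldCalculus.grad L⁻¹`), `bgGaugeU e_k 1 ∘ Q′*`,
`blockGaugeUj e_k (L^iη) Q′*_{k−i+1} Λ₁^{(i)*}` ((4.17)); data: `Qadj` = `Q′*` to the unit lattice, `QadjJ i` = `Q′*_{k−i+1}`,
`ξ i = L^iη`, `Λ₁ i` = `Λ₁^{(i)*}`. [cite: BalabanImbrieJaffe1988, (5.2.9) p.279] -/
def Invariant529 {α : Type*} {k : ℕ} (ek L : ℝ) (ξ : ℕ → ℝ)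
    (Qadj : (Balaban1983to89.Site P (k + 1) → ℝ) →ₗ[ℝ] (Balaban1983to89.Site P k → ℝ))
    (QadjJ : (i : ℕ) → (Balaban1983to89.Site P (k + 1) → ℝ) →ₗ[ℝ] (Balaban1983to89.Site P i → ℝ))
    (Λ₁ : (i : ℕ) → Finset (PBond P i))
    (F : (Balaban1983to89.Site P (k + 1) → ℂ) → (Balaban1983to89.Site P k → ℂ) → (PBond P (k + 1) → ℂ) → (PBond P k → ℂ) →
      ((i : ℕ) → PBond P i → ℂ) → α) : Prop :=
  ∀ (lam : Balaban1983to89.Site P (k + 1) → ℝ) ψ φ v u uj,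
    F (bgGaugePhi ek lam ψ) (bgGaugePhi ek (Qadj lam) φ) (bgGaugeU ek L lam v) (bgGaugeU ek 1 (Qadj lam) u)
        (fun i => blockGaugeUj ek (ξ i) (QadjJ i) (Λ₁ i) lam (uj i))
      = F ψ φ v u uj

/-- kernel (p. 279, verbatim: *"For example, it is easily seen that the characteristic functions we have inserted are invariant."*):
any function of `|φ(x)|` alone — such as `χ_x` of (5.2.2) — is invariant under (5.2.9). [cite: BalabanImbrieJaffe1988, (5.2.9) p.279] -/
theorem invariant529_chiX {k : ℕ} (ek L : ℝ) (ξ : ℕ → ℝ)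
    (Qadj : (Balaban1983to89.Site P (k + 1) → ℝ) →ₗ[ℝ] (Balaban1983to89.Site P k → ℝ))
    (QadjJ : (i : ℕ) → (Balaban1983to89.Site P (k + 1) → ℝ) →ₗ[ℝ] (Balaban1983to89.Site P i → ℝ))
    (Λ₁ : (i : ℕ) → Finset (PBond P i)) (χ : CutoffProfile) (lamk pek s lam : ℝ) (d : ℕ) (x : Balaban1983to89.Site P k) :
    Invariant529 ek L ξ Qadj QadjJ Λ₁ (fun _ φ _ _ _ => chiX χ lamk pek s lam d (φ x)) := by
  intro lam' ψ φ v u uj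
  simp only [bgGaugePhi]
  exact chiX_mul_phase χ lamk pek s lam d (φ x) _

/-- kernel: `χ_p` of (5.2.2), a function of the unit-lattice plaquette variable `u(p)`, is invariant under (5.2.9) (the map on
`u` is the gauge transformation of Sect. 3 with parameter `e_kQ′*λ`, `BIJ88Sect4Statements.bgGaugeU_eq`).
[cite: BalabanImbrieJaffe1988, (5.2.9) p.279] -/
theorem invariant529_chiP {k : ℕ} (ek L : ℝ) (ξ : ℕ → ℝ)
    (Qadj : (Balaban1983to89.Site P (k + 1) → ℝ) →ₗ[ℝ] (Balaban1983to89.Site P k → ℝ))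
    (QadjJ : (i : ℕ) → (Balaban1983to89.Site P (k + 1) → ℝ) →ₗ[ℝ] (Balaban1983to89.Site P i → ℝ))
    (Λ₁ : (i : ℕ) → Finset (PBond P i)) (χ : CutoffProfile) (pek : ℝ) (p : Plaq P k) :
    Invariant529 ek L ξ Qadj QadjJ Λ₁ (fun _ _ _ u _ => chiP χ ek pek (plaqVar u p)) := by
  intro lam' ψ φ v u uj
  simp only
  rw [bgGaugeU_eq one_ne_zero, plaqVar_gauge]

/-- kernel: at `λ = 0` every map in (5.2.9) is the identity. [cite: BalabanImbrieJaffe1988, (5.2.9) p.279] -/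
theorem invariant529_apply_zero {α : Type*} {k : ℕ} (ek L : ℝ) (ξ : ℕ → ℝ)
    (Qadj : (Balaban1983to89.Site P (k + 1) → ℝ) →ₗ[ℝ] (Balaban1983to89.Site P k → ℝ))
    (QadjJ : (i : ℕ) → (Balaban1983to89.Site P (k + 1) → ℝ) →ₗ[ℝ] (Balaban1983to89.Site P i → ℝ))
    (Λ₁ : (i : ℕ) → Finset (PBond P i))
    (F : (Balaban1983to89.Site P (k + 1) → ℂ) → (Balaban1983to89.Site P k → ℂ) → (PBond P (k + 1) → ℂ) → (PBond P k → ℂ) →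
      ((i : ℕ) → PBond P i → ℂ) → α) (ψ φ v u uj) :
    F (bgGaugePhi ek 0 ψ) (bgGaugePhi ek (Qadj 0) φ) (bgGaugeU ek L 0 v) (bgGaugeU ek 1 (Qadj 0) u)
        (fun i => blockGaugeUj ek (ξ i) (QadjJ i) (Λ₁ i) 0 (uj i)) = F ψ φ v u uj := by
  have h1 : ∀ {i : ℕ} (g : Balaban1983to89.Site P i → ℂ), bgGaugePhi ek 0 g = g := by
    intro i g; funext x; simp [bgGaugePhi]
  have h2 : ∀ {i : ℕ} (η : ℝ) (w : PBond P i → ℂ), bgGaugeU ek η 0 w = w := by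
    intro i η w; funext b; simp [bgGaugeU, LatticeFieldCalculus.grad]
  have h3 : ∀ i, blockGaugeUj ek (ξ i) (QadjJ i) (Λ₁ i) 0 (uj i) = uj i := fun i => blockGaugeUj_zero _ _ _ _ _
  simp only [map_zero, h1, h2, h3]

/-! ## (5.3.1)–(5.3.4): the first gauge field translation -/

/-- kernel (plumbing): decidability of membership of a bond in a finite set of bonds. [folklore] -/
private instance instDecEqPBond : DecidableEq (PBond P j) := fun a b =>
  decidable_of_iff (a.src = b.src ∧ a.dir = b.dir)
    ⟨fun h => by cases a; cases b; cases h; congr, fun h => by subst h; exact ⟨rfl, rfl⟩⟩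

/-- **(5.3.1)** p. 280 [PDF 24], verbatim: *"5.3. First Gauge Field Translation. The first translation is done in Λ₁^{(k)*}, and it
removes the v-field from the δ-functions there. As in (3.24) we put u = u′(Λ₁^{(k)*}Q^{s*}v), (5.3.1) cf. also (I.6.2)."* — pointwise
on unit-lattice bonds: `u = u′·(Q^{s*}v)` on `Λ₁^{(k)*}`, `u = u′` elsewhere (`Qssv = Q^{s*}v` as data).
[cite: BalabanImbrieJaffe1988, (5.3.1) p.280] -/
def transl531 (Λ1s : Finset (PBond P j)) (u' Qssv : PBond P j → ℂ) : PBond P j → ℂ :=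
  fun b => if b ∈ Λ1s then u' b * Qssv b else u' b

/-- p. 280 [PDF 24], verbatim: *"Using the restrictions |u(p) − 1| ≦ e_kp(e_k) in Λ₀^{(k)**}, and the axial gauge conditions, we
obtain that u′_b = e^{ie_kA′_b} with |A′_b| ≦ cp(e_k), for b ∈ Λ₁^{(k)*}."* — the parametrization `u′ = e^{ie_kA′}`.
[cite: BalabanImbrieJaffe1988, (5.3.1) p.280] -/
def uPrime (ek : ℝ) (A' : PBond P j → ℝ) : PBond P j → ℂ :=
  fun b => exp (I * (ek * A' b : ℝ))

/-- p. 280, the asserted smallness *"|A′_b| ≦ cp(e_k), for b ∈ Λ₁^{(k)*}"* (a consequence of the restrictions and the axial gauge,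
stated; the constant `c` explicit). [cite: BalabanImbrieJaffe1988, (5.3.1) p.280] -/
def SmallAPrime (c pek : ℝ) (Λ1s : Finset (PBond P j)) (A' : PBond P j → ℝ) : Prop :=
  ∀ b ∈ Λ1s, |A' b| ≤ c * pek

/-- p. 280 [PDF 24], verbatim: *"Let us define f(p) = (ie_k)^{−1} log v(p). The restrictions on u(p) and the fact that v = Qu imply
that |f(p)| ≦ cp(e_k) for p ∈ Λ₀^{(k)′*} [sic: plaquettes, Λ₀^{(k)′**} in (5.9.1)]."* — `f` = `BIJ88Sect3Statements.fieldStrength e_k ∘ v`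
on the block lattice; the asserted bound as a predicate over the plaquettes of the region. [cite: BalabanImbrieJaffe1988, (5.3.1) p.280] -/
def SmallF (c pek ek : ℝ) (Λ0' : Finset (Balaban1983to89.Site P j)) (v : Plaq P j → ℂ) : Prop :=
  ∀ p ∈ starP Λ0', ‖fieldStrength ek (v p)‖ ≤ c * pek

/-- The exponential background form shared by (5.3.3)–(5.3.4), (5.4.2), (5.4.6), (5.4.10), (5.5.13)–(5.5.14), (5.6.1):
`b ↦ (Q^{s*}_{k+1}v)(b) · exp ie_kη[X](b)` for a real bracket `X` (e.g. (5.3.4) p. 280, verbatim: *"u_k = (Q^{s*}_{k+1}) exp ie_kη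
[Q^{s*}_kA′ − 𝒟_{k,loc}∂*Q^{e*}_k(∂A′ + L^{−2}Q^{e*}f)], (5.3.4)"* — TRANSCRIPTION NOTE: `(Q^{s*}_{k+1})` printed without its argument
`v`, cf. (5.3.3), (5.4.2)). [cite: BalabanImbrieJaffe1988, (5.3.4) p.280] -/
def bgExp {B : Type*} (ek η : ℝ) (Q : B → ℂ) (X : B → ℝ) : B → ℂ :=
  fun b => Q b * exp (I * (ek * η * X b : ℝ))

/-- kernel: the exponential background form is `BIJ88Sect4Statements.backgroundU` ((4.2)) with the opposite sign of the bracket.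
[cite: BalabanImbrieJaffe1988, (5.3.4) p.280] -/
theorem bgExp_eq_backgroundU {B : Type*} (ek η : ℝ) (Q : B → ℂ) (X : B → ℝ) :
    bgExp ek η Q X = backgroundU ek η Q (fun b => -X b) := by
  funext b
  simp only [bgExp, backgroundU]
  congr 1
  push_cast
  ring_nf

/-- **(5.3.4)** p. 280 [PDF 24], the bracket `Q^{s*}_kA′ − 𝒟_{k,loc}∂*Q^{e*}_k(∂A′ + L^{−2}Q^{e*}f)` as a real bond function, over the
linear maps `Qss = Q^{s*}_k` (unit-lattice bond functions → η-lattice bond functions), `T = 𝒟_{k,loc}∂*Q^{e*}_k` (unit-lattice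
plaquette functions → η-lattice bond functions), `dd = ∂` (unit-lattice curl), `Qes = Q^{e*}` (block-lattice plaquette functions →
unit-lattice plaquette functions). [cite: BalabanImbrieJaffe1988, (5.3.4) p.280] -/
def bracket534 {B₁ B Pl₁ Plc : Type*} (L : ℝ) (Qss : (B₁ → ℝ) →ₗ[ℝ] (B → ℝ)) (T : (Pl₁ → ℝ) →ₗ[ℝ] (B → ℝ))
    (dd : (B₁ → ℝ) →ₗ[ℝ] (Pl₁ → ℝ)) (Qes : (Plc → ℝ) →ₗ[ℝ] (Pl₁ → ℝ)) (A' : B₁ → ℝ) (f : Plc → ℝ) : B → ℝ :=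
  Qss A' - T (dd A' + L⁻¹ ^ 2 • Qes f)

/-- **(5.3.4)** p. 280 [PDF 24]: *"In Λ̄₂^{(k)*} this simplifies to u_k = (Q^{s*}_{k+1}[v]) exp ie_kη[Q^{s*}_kA′ − 𝒟_{k,loc}∂*Q^{e*}_k
(∂A′ + L^{−2}Q^{e*}f)], (5.3.4) cf. (I.6.2.3)."* — the background field after the first translation, in `Λ̄₂^{(k)*}`.
[cite: BalabanImbrieJaffe1988, (5.3.4) p.280] -/
def bg534 {B₁ B Pl₁ Plc : Type*} (ek η L : ℝ) (Qss1v : B → ℂ) (Qss : (B₁ → ℝ) →ₗ[ℝ] (B → ℝ))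
    (T : (Pl₁ → ℝ) →ₗ[ℝ] (B → ℝ)) (dd : (B₁ → ℝ) →ₗ[ℝ] (Pl₁ → ℝ)) (Qes : (Plc → ℝ) →ₗ[ℝ] (Pl₁ → ℝ))
    (A' : B₁ → ℝ) (f : Plc → ℝ) : B → ℂ :=
  bgExp ek η Qss1v (bracket534 L Qss T dd Qes A' f)

/-! ## (5.4.1)–(5.4.4), (5.4.9): the gauge transformation as operator algebra -/

section OperatorAlgebra

variable {R : Type*} [Ring R]

/-- **(5.4.3)** p. 282 [PDF 26], verbatim: *"We now write (Q^{s*}_k − 𝒟_{k,loc}∂*Q^{e*}_k∂)□A′ = (Q^{s*}_k − 𝒟_k∂*Q^{e*}_k∂)□A′ + w′₁A′.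
(5.4.3) The kernel w′₁ = (𝒟_k − 𝒟_{k,loc})∂*Q*_k∂□ involves only the tails not included in the expansion (2.12)."* — in a ring of
operators (`ds` = ∂*, `Qes` = Q^{e*}_k, `d` = ∂, `box` = □, the restriction to the ½r(e_k)-cube of p. 281).
[cite: BalabanImbrieJaffe1988, (5.4.3) p.282] -/
def wPrime1 (Dk Dloc ds Qes d box : R) : R := (Dk - Dloc) * ds * Qes * d * box

/-- kernel: (5.4.3) holds with `w′₁` so defined. [cite: BalabanImbrieJaffe1988, (5.4.3) p.282] -/
theorem eq543 (Qss Dk Dloc ds Qes d box : R) :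
    (Qss - Dloc * ds * Qes * d) * box = (Qss - Dk * ds * Qes * d) * box + wPrime1 Dk Dloc ds Qes d box := by
  simp only [wPrime1]; noncomm_ring

/-- **(5.4.4)** p. 282 [PDF 26], verbatim: *"We have put w₁ = w′₁ + H_k□ − H_{k,loc}, and it satisfies the same bounds as w′₁."*
[cite: BalabanImbrieJaffe1988, (5.4.4) p.282] -/
def w1 (Dk Dloc ds Qes d box Hk Hloc : R) : R := wPrime1 Dk Dloc ds Qes d box + Hk * box - Hloc

/-- **(5.4.4)** p. 282 [PDF 26], verbatim: *"The nonlocal gauge transformation (5.4.1) is now applied and we have (Q^{s*}_k −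
𝒟_{k,loc}∂*Q^{e*}_k∂)□A′ = (H_k + ∂C_k)□A′ + w′₁A′ = H_{k,loc}A′ + ∂C_k□A′ + w₁A′. (5.4.4)"* — PROVED in any ring from (5.4.1) =
**(2.20)** (`BIJ88Sect2Statements.Eq220 : Q^{s*}_k − 𝒟_k∂*Q^{e*}_k∂ = H_k + ∂C_k`). [cite: BalabanImbrieJaffe1988, (5.4.4) p.282] -/
theorem eq544 {Qss Dk ds Qes d Hk Ck : R} (h : BIJ88Sect2Statements.Eq220 Qss Dk ds Qes d Hk Ck) (Dloc box Hloc : R) :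
    (Qss - Dloc * ds * Qes * d) * box = (Hk + d * Ck) * box + wPrime1 Dk Dloc ds Qes d box ∧
    (Qss - Dloc * ds * Qes * d) * box = Hloc + d * Ck * box + w1 Dk Dloc ds Qes d box Hk Hloc := by
  unfold BIJ88Sect2Statements.Eq220 at h
  refine ⟨?_, ?_⟩
  · rw [eq543, h]
  · rw [eq543, h, w1]; noncomm_ring

/-- **(5.6.5)** p. 286 [PDF 30], verbatim: *"Our desired bound now follows because by (5.4.4), (Q^{s*}_k − 𝒟_{k,loc}∂*Q^{e*}_k∂)□′B =
(H_{k,loc} + ∂C_k + w₁)□′B. (5.6.5)"* — PROVED from (2.20) for an idempotent restriction `□′` (`box * box = box`), `w₁` formed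
with `□ = □′`. [cite: BalabanImbrieJaffe1988, (5.6.5) p.286] -/
theorem eq565 {Qss Dk ds Qes d Hk Ck : R} (h : BIJ88Sect2Statements.Eq220 Qss Dk ds Qes d Hk Ck) {box : R}
    (hbox : box * box = box) (Dloc Hloc : R) :
    (Qss - Dloc * ds * Qes * d) * box = (Hloc + d * Ck + w1 Dk Dloc ds Qes d box Hk Hloc) * box := by
  have h2 := (eq544 h Dloc box Hloc).2
  calc (Qss - Dloc * ds * Qes * d) * box = (Qss - Dloc * ds * Qes * d) * (box * box) := by rw [hbox]
    _ = (Qss - Dloc * ds * Qes * d) * box * box := (mul_assoc _ _ _).symm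
    _ = (Hloc + d * Ck * box + w1 Dk Dloc ds Qes d box Hk Hloc) * box := by rw [h2]
    _ = (Hloc + d * Ck + w1 Dk Dloc ds Qes d box Hk Hloc) * box := by
        simp only [add_mul, mul_assoc, hbox]

/-- **(5.4.7)** p. 282 [PDF 26], the kernel, verbatim: *"The scalar fields appear as φ(x)exp[ie_k(w₂A′)(x)], ψ(y)exp[ie_k(w₂A′)(y)],
where w₂ = Λ̄₃^{(k)}C_{k,loc} − Λ̄₃^{(k)}C_k□"* (its bound (5.4.7) is `BIJ88Sect5StatementsPart2.Ineq547`).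
[cite: BalabanImbrieJaffe1988, (5.4.7) p.282] -/
def w2 (Λ3 Cloc Ck box : R) : R := Λ3 * Cloc - Λ3 * Ck * box

/-- **(5.4.9)** p. 283 [PDF 27], the kernel, verbatim: *"Here w₅ = [(𝒟_{k,loc} − 𝒟_k)∂*Q^{e*}_k∂ + H_k − H_{k,loc}]Λ₃^{(k)*} is another
small, exponentially decaying kernel."* — TRANSCRIPTION NOTE (kernel-located sign slip, recorded): the second equality of (5.4.9)
follows from (5.4.1) exactly iff the first term reads `(𝒟_k − 𝒟_{k,loc})∂*Q^{e*}_k∂` (as in `w′₁` (5.4.3)); typed with that sign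
(`eq549`), the printed sign being refuted in a commutative instance (`eq549_asPrinted_false`).  Only |w₅| is ever used.
[cite: BalabanImbrieJaffe1988, (5.4.9) p.283] -/
def w5 (Dk Dloc ds Qes d Hk Hloc Λ3 : R) : R := ((Dk - Dloc) * ds * Qes * d + Hk - Hloc) * Λ3

/-- **(5.4.9)** p. 283 [PDF 27], first equality, verbatim: *"Λ̄₂^{(k)*}(Q^{s*}_k − 𝒟_{k,loc}∂*Q^{e*}_k∂)A′ = Λ̄₂^{(k)*}(Q^{s*}_k −
𝒟_{k,loc}∂*Q^{e*}_k∂)Λ₃^{(k)*c}A′ + (Q^{s*}_k − 𝒟_{k,loc}∂*Q^{e*}_k∂)Λ₃^{(k)*}A′"* — PROVED for complementary restrictions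
`Λ3 + Λ3c = 1` under the range hypothesis `Λ̄₂XΛ₃ = XΛ₃` (the operator `X` applied to fields in `Λ₃^{(k)*}` lands in `Λ̄₂^{(k)*}`).
[cite: BalabanImbrieJaffe1988, (5.4.9) p.283] -/
theorem eq549_split {X Λ2 Λ3 Λ3c : R} (hcompl : Λ3 + Λ3c = 1) (hrange : Λ2 * X * Λ3 = X * Λ3) :
    Λ2 * X = Λ2 * X * Λ3c + X * Λ3 := by
  calc Λ2 * X = Λ2 * X * (Λ3 + Λ3c) := by rw [hcompl, mul_one]
    _ = Λ2 * X * Λ3c + X * Λ3 := by rw [mul_add, hrange, add_comm]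

/-- **(5.4.9)** p. 283 [PDF 27], second equality, verbatim: *"… = Λ̄₂^{(k)*}(Q^{s*}_k − 𝒟_{k,loc}∂*Q^{e*}_k∂)Λ₃^{(k)*c}A′ +
H_{k,loc}Λ₃^{(k)*}A′ + ∂C_kΛ₃^{(k)*}A′ + w₅A′. (5.4.9)"* — the `Λ₃^{(k)*}` part, PROVED from (5.4.1) = (2.20) with `w₅` as typed
(corrected sign). [cite: BalabanImbrieJaffe1988, (5.4.9) p.283] -/
theorem eq549 {Qss Dk ds Qes d Hk Ck : R} (h : BIJ88Sect2Statements.Eq220 Qss Dk ds Qes d Hk Ck) (Dloc Hloc Λ3 : R) :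
    (Qss - Dloc * ds * Qes * d) * Λ3 = Hloc * Λ3 + d * Ck * Λ3 + w5 Dk Dloc ds Qes d Hk Hloc Λ3 := by
  unfold BIJ88Sect2Statements.Eq220 at h
  have : Qss - Dloc * ds * Qes * d = Hk + d * Ck + (Dk - Dloc) * ds * Qes * d := by
    rw [← h]; noncomm_ring
  rw [this, w5]; noncomm_ring

/-- kernel witness of the sign slip in (5.4.9): with the PRINTED first term `(𝒟_{k,loc} − 𝒟_k)∂*Q^{e*}_k∂` of `w₅` the second
equality of (5.4.9) does not follow from (5.4.1) — in the commutative ring ℝ take 𝒟_k = ∂* = Q^{e*}_k = ∂ = Λ₃ = C_k = 1,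
𝒟_{k,loc} = H_k = H_{k,loc} = 0, Q^{s*}_k = 2: (5.4.1) holds (2 − 1 = 0 + 1) while the printed right side is 0 + 1 + (0 − 1) = 0 ≠ 2.
[cite: BalabanImbrieJaffe1988, (5.4.9) p.283] -/
theorem eq549_asPrinted_false :
    ¬ ∀ (S : Type) [CommRing S] (Qss Dk Dloc ds Qes d Hk Ck Hloc Λ3 : S),
      BIJ88Sect2Statements.Eq220 Qss Dk ds Qes d Hk Ck →
        (Qss - Dloc * ds * Qes * d) * Λ3 = Hloc * Λ3 + d * Ck * Λ3 + ((Dloc - Dk) * ds * Qes * d + Hk - Hloc) * Λ3 := by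
  intro h
  have := h ℝ 2 1 0 1 1 1 0 1 0 1 (by unfold BIJ88Sect2Statements.Eq220; norm_num)
  norm_num at this

end OperatorAlgebra

/-! ## (5.4.5)–(5.4.6): the background gauge transformation acting on the exponential form -/

/-- kernel, the mechanism of (5.4.5) → (5.4.6), pp. 282: the background gauge transformation (4.16)/(5.4.5)
`u_{k,b} → u_{k,b} exp(−ie_kη(∂λ)(b))` (`BIJ88Sect4Statements.bgGaugeU`, `∂` = `∂^η` = `LatticeFieldCalculus.grad η⁻¹`) acts on
the exponential form by SUBTRACTING `∂^ηλ` from the bracket — with `λ = Λ̄₃^{(k)}C_k□A′` this removes the term `∂Λ̄₃^{(k)}C_k□A′`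
from (5.4.2)/(5.4.4), leaving (5.4.6) (verbatim: *"u′_k = (Q^{s*}_{k+1}v) exp ie_kη[H_{k,loc}A′ + ∂Λ̄₃^{(k)c}C_k□A′ + w₁A′ −
L^{−2}𝒟_{k,loc}∂*Q^{e*}_{k+1}f], (5.4.6)"*). [cite: BalabanImbrieJaffe1988, (5.4.6) p.282] -/
theorem bgGaugeU_bgExp (ek η : ℝ) (lam : Balaban1983to89.Site P j → ℝ) (Q : PBond P j → ℂ) (X : PBond P j → ℝ) :
    bgGaugeU ek η lam (bgExp ek η Q X) = bgExp ek η Q (fun b => X b - LatticeFieldCalculus.grad η⁻¹ lam b) := by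
  funext b
  simp only [bgGaugeU, bgExp]
  rw [mul_assoc, ← Complex.exp_add]
  congr 2
  push_cast
  ring

/-- kernel: the splitting `∂C_k□A′ = ∂Λ̄₃^{(k)}C_k□A′ + ∂Λ̄₃^{(k)c}C_k□A′` used between (5.4.4) and (5.4.6) — the gradient is
additive over a decomposition `λ = λ₃ + λ₃c` of the gauge function. [cite: BalabanImbrieJaffe1988, (5.4.6) p.282] -/
theorem grad_add_decomp (c : ℝ) (lam lam3 lam3c : Balaban1983to89.Site P j → ℝ) (h : ∀ x, lam x = lam3 x + lam3c x)
    (b : PBond P j) :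
    LatticeFieldCalculus.grad c lam b = LatticeFieldCalculus.grad c lam3 b + LatticeFieldCalculus.grad c lam3c b := by
  simp only [LatticeFieldCalculus.grad, h, smul_eq_mul]
  ring

/-- kernel: two successive background gauge transformations of the scalar field compose additively in the gauge function —
the bookkeeping behind *"φ′(x) = φ(x)e^{ie_k(Λ̄₃^{(k)}C_{k,loc}A′)(x)}"* and the residual phases `exp[ie_k(w₂A′)(x)]` of p. 282.
[cite: BalabanImbrieJaffe1988, (5.4.7) p.282] -/
theorem bgGaugePhi_bgGaugePhi (ek : ℝ) (lam mu : Balaban1983to89.Site P j → ℝ) (φ : Balaban1983to89.Site P j → ℂ) :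
    bgGaugePhi ek lam (bgGaugePhi ek mu φ) = bgGaugePhi ek (fun x => mu x + lam x) φ := by
  funext x
  simp only [bgGaugePhi]
  rw [mul_assoc, ← Complex.exp_add]
  congr 2
  push_cast
  ring

/-! ## (5.5.1), (5.5.2), (5.5.4), (5.5.7), (5.5.11): the second gauge field translation -/

section SecondTranslation

variable {R : Type*} [Ring R]

/-- **(5.5.1)** p. 283 [PDF 27], verbatim: *"The linear term is almost equal to ⟨Λ₁^{(k)**}L^{−2}Q^{e*}f, Q^e_k∂H_kA′⟩, since by
(I.6.1.5), (2.15) we have σ_k∂A′ = Q^e_k∂H_kA′. (5.5.1)"* — as an operator identity (`d1` = the unit-lattice ∂ on the left, `dη` the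
η-lattice ∂ on the right). [cite: BalabanImbrieJaffe1988, (5.5.1) p.283] -/
def Eq551 (σ d1 Qe dη Hk : R) : Prop := σ * d1 = Qe * dη * Hk

/-- **(5.5.4)** p. 284 [PDF 28], the kernels, verbatim: *"σ_{k,loc}∂Λ₂^{(k)*}A^{(k)} = σ_{k,loc}∂Λ₂^{(k)*}□A^{(k)} = σ_k∂Λ₂^{(k)*}□A^{(k)} +
w′₃A^{(k)} = Q^e_k∂^ηH_kΛ₂^{(k)*}□A^{(k)} + w′₃A^{(k)} = Q^e_k∂^ηH_{k,loc}Λ₂^{(k)*}A^{(k)} + w″₃A^{(k)}. (5.5.4) … The precise form of the error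
terms will be unimportant; only bounds like (5.5.5) will matter."* — `w′₃ := (σ_{k,loc} − σ_k)∂Λ₂^{(k)*}□`.
[cite: BalabanImbrieJaffe1988, (5.5.4) p.284] -/
def wPrime3 (σloc σ d1 Λ2 box : R) : R := (σloc - σ) * d1 * Λ2 * box

/-- **(5.5.4)**, `w″₃ := w′₃ + Q^e_k∂^η(H_kΛ₂^{(k)*}□ − H_{k,loc}Λ₂^{(k)*})` (the remainder of the last equality, DEFINED as a remainder).
[cite: BalabanImbrieJaffe1988, (5.5.4) p.284] -/
def wDoublePrime3 (σloc σ d1 Λ2 box Qe dη Hk Hloc : R) : R :=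
  wPrime3 σloc σ d1 Λ2 box + Qe * dη * (Hk * Λ2 * box - Hloc * Λ2)

/-- kernel: the chain (5.5.4) holds with `w′₃`, `w″₃` so defined, given (5.5.1) and the range statement `σ_{k,loc}∂Λ₂^{(k)*} =
σ_{k,loc}∂Λ₂^{(k)*}□` of its first equality. [cite: BalabanImbrieJaffe1988, (5.5.4) p.284] -/
theorem eq554 {σloc σ d1 Λ2 box Qe dη Hk : R} (h551 : Eq551 σ d1 Qe dη Hk) (hrange : σloc * d1 * Λ2 = σloc * d1 * Λ2 * box)
    (Hloc : R) :
    σloc * d1 * Λ2 = σ * d1 * Λ2 * box + wPrime3 σloc σ d1 Λ2 box ∧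
    σloc * d1 * Λ2 = Qe * dη * Hk * Λ2 * box + wPrime3 σloc σ d1 Λ2 box ∧
    σloc * d1 * Λ2 = Qe * dη * Hloc * Λ2 + wDoublePrime3 σloc σ d1 Λ2 box Qe dη Hk Hloc := by
  unfold Eq551 at h551
  have e1 : σloc * d1 * Λ2 = σ * d1 * Λ2 * box + wPrime3 σloc σ d1 Λ2 box := by
    rw [hrange, wPrime3]; noncomm_ring
  refine ⟨e1, ?_, ?_⟩
  · rw [e1, h551]
  · rw [e1, h551, wDoublePrime3, wPrime3]; noncomm_ring

/-- **(5.5.7)** p. 284 [PDF 28], verbatim: *"The first Λ₅^{(k)′**} term involves C^{(k)}_{loc}∂*σ_{k,loc}∂ = I + w‴₃, (5.5.7) with another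
small, short-ranged kernel w‴₃."* — `w‴₃` DEFINED as the remainder. [cite: BalabanImbrieJaffe1988, (5.5.7) p.284] -/
def wTriplePrime3 (Cloc ds σloc d : R) : R := Cloc * ds * σloc * d - 1

/-- kernel: (5.5.7) holds with `w‴₃` so defined. [cite: BalabanImbrieJaffe1988, (5.5.7) p.284] -/
theorem eq557 (Cloc ds σloc d : R) : Cloc * ds * σloc * d = 1 + wTriplePrime3 Cloc ds σloc d := by
  rw [wTriplePrime3]; abel

/-- **(5.5.11)** p. 285 [PDF 29], verbatim: *"𝒟_{k,loc} + H_{k,loc}C^{(k)}_{loc}H*_{k,loc} = 𝒟^η_{k+1,loc}, (5.5.11)"* — PROVED: with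
`𝒟_{k,loc} = Σ_{j<k} H_{j,loc}C^{(j)}_{loc}H*_{j,loc}` ((2.12), `BIJ88Sect2Statements.curlyDloc`) this is the recursion step
(scalings to the η-lattice suppressed, as in (2.12)). [cite: BalabanImbrieJaffe1988, (5.5.11) p.285] -/
theorem eq5511 (Hloc Cloc Hsloc : ℕ → R) (k : ℕ) :
    BIJ88Sect2Statements.curlyDloc Hloc Cloc Hsloc k + Hloc k * Cloc k * Hsloc k
      = BIJ88Sect2Statements.curlyDloc Hloc Cloc Hsloc (k + 1) := by
  simp [BIJ88Sect2Statements.curlyDloc, BIJ85Sect4Statements.curlyD, Finset.sum_range_succ]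

end SecondTranslation

section Fields

variable {M : Type*} [AddCommGroup M] [Module ℝ M]

/-- **(5.5.2)** p. 283 [PDF 27], verbatim: *"The translation we actually use is localized, and is given by A′ = A^{(k)} −
Λ₄^{(k)*}L^{−2}C^{(k)}_{loc}H*_{k,loc}∂*Q^{e*}_{k+1}f. (5.5.2)"* — over a real vector space of bond/plaquette functions with the operators as
linear endomorphisms (`Λ4` = the restriction to `Λ₄^{(k)*}`, `X = ∂*Q^{e*}_{k+1}`). [cite: BalabanImbrieJaffe1988, (5.5.2) p.283] -/
def transl552 (L : ℝ) (Λ4 Cloc Hsloc X : Module.End ℝ M) (A f : M) : M :=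
  A - L⁻¹ ^ 2 • Λ4 (Cloc (Hsloc (X f)))

/-- kernel: p. 284, *"Our construction of a C^{(k)}_{loc} satisfying (2.10), (2.11) ensures that δ_Ax(A′) = δ_Ax(A^{(k)}), δ(QA′) =
δ(QA^{(k)})"* — the block averages agree, `QA′ = QA^{(k)}`, whenever `QΛ₄^{(k)*}C^{(k)}_{loc} = 0` (the constraint (2.10) `QC^{(k)}_{loc} = 0`
in its localized form).
READING NOTE (v1.2, owner r16; HOME/GAPS.md G-C2-08, owner ruling = reading (a)): for the PRINTED operator order of (5.5.2) the
hypothesis `hQ : Q * Λ4 * Cloc = 0` is NOT available from (2.10)–(2.11) — on the concrete kernels it fails exactly at the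
`∂Λ₄^{(k)}`-straddling `L`-bonds (`BIJ88Eq552CutoffWitness.cutoff_witness`, `BIJ88Eq552CutoffLocus.cutoff_locus`, seat p31) — so this
theorem is a correct implication with an undischargeable premise there; with the cut-off INSIDE the localized covariance the printed
sentence holds by (2.10) alone: `Q_transl552_inside` at the end of this file (concrete form `BIJ88Eq552CutoffWitness.qKer_mul_clocKer_mul`).
[cite: BalabanImbrieJaffe1988, (5.5.2) p.283] -/
theorem Q_transl552 (L : ℝ) {Q Λ4 Cloc : Module.End ℝ M} (hQ : Q * Λ4 * Cloc = 0) (Hsloc X : Module.End ℝ M) (A f : M) :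
    Q (transl552 L Λ4 Cloc Hsloc X A f) = Q A := by
  have h0 : Q (Λ4 (Cloc (Hsloc (X f)))) = 0 := by
    have := congrArg (fun T : Module.End ℝ M => T (Hsloc (X f))) hQ
    simpa [Module.End.mul_apply] using this
  simp [transl552, map_sub, map_smul, h0]

/-- kernel, (5.5.13) → (5.5.14) p. 285, verbatim: *"u′_k = (Q^{s*}_{k+1}v) exp ie_kη[(w₁ + H_{k,loc})(A^{(k)} − Λ₄^{(k)*}L^{−2}
C^{(k)}_{loc}H*_{k,loc}∂*Q^{e*}_{k+1}f) + ∂Λ̄₃^{(k)c}C_k□A^{(k)} − L^{−2}𝒟_{k,loc}∂*Q^{e*}_{k+1}f]. (5.5.13) In Λ₅^{(k)*} we apply (5.5.11) to obtain u′_k =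
(Q^{s*}_{k+1}v) exp ie_kη[H_{k,loc}A^{(k)} − L^{−2}𝒟^η_{k+1,loc}∂*Q^{e*}_{k+1}f + w₁A′]. (5.5.14)"* — the bracket computation, PROVED over linear
endomorphisms: inside `Λ₅^{(k)*}` (where `Λ₄^{(k)*}` acts as the identity and the `∂Λ̄₃^{(k)c}` term is absent) the bracket of
(5.5.13) with `A′ = A^{(k)} − L^{−2}C_{loc}H*_{loc}Xf` equals that of (5.5.14), by (5.5.11) `𝒟_{k,loc} + H_{k,loc}C_{loc}H*_{k,loc} =
𝒟_{k+1,loc}`. [cite: BalabanImbrieJaffe1988, (5.5.14) p.285] -/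
theorem eq5514 (L : ℝ) (w1 Hloc Cloc Hsloc Dloc Dnext X : Module.End ℝ M) (h5511 : Dloc + Hloc * Cloc * Hsloc = Dnext)
    (A f : M) :
    (w1 + Hloc) (transl552 L 1 Cloc Hsloc X A f) - L⁻¹ ^ 2 • Dloc (X f)
      = Hloc A - L⁻¹ ^ 2 • Dnext (X f) + w1 (transl552 L 1 Cloc Hsloc X A f) := by
  rw [← h5511]
  simp only [transl552, LinearMap.add_apply, Module.End.one_apply, map_sub, map_smul, Module.End.mul_apply]
  module

end Fields

/-! ## (5.6.1): the cutoff `θ_k` and the new background field; (5.6.6)/(5.7.1): the product formulas -/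

/-- **Sect. 5.6** p. 285 [PDF 29], verbatim: *"Let θ_k be a function on T*_η that equals 1 in Λ̄₆^{(k)*}, 0 in Λ̄₅^{(k)*c}, and changes
smoothly from 0 to 1 in a neighborhood of Λ̄₆^{(k)*} of thickness M = O(1)."* — the two support clauses as a predicate on a bond
function (the smoothness clause, qualitative in print, is not typed). [cite: BalabanImbrieJaffe1988, (5.6.1) p.285] -/
def IsTheta561 {B : Type*} (Λ6s Λ5s : Set B) (θ : B → ℝ) : Prop :=
  (∀ b ∈ Λ6s, θ b = 1) ∧ ∀ b ∉ Λ5s, θ b = 0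

/-- **(5.6.1)** p. 285 [PDF 29], the bracket `(1 − θ_k)H_{k,loc}A^{(k)} − L^{−2}𝒟^η_{k+1,loc}∂*Q^{e*}_{k+1}f` pointwise, over the bond
functions `HA = H_{k,loc}A^{(k)}` and `DXf = 𝒟^η_{k+1,loc}∂*Q^{e*}_{k+1}f` (data). [cite: BalabanImbrieJaffe1988, (5.6.1) p.285] -/
def bracket561 {B : Type*} (L : ℝ) (θ HA DXf : B → ℝ) : B → ℝ :=
  fun b => (1 - θ b) * HA b - L⁻¹ ^ 2 * DXf b

/-- **(5.6.1)** p. 285 [PDF 29], verbatim: *"The new background field for the action and observables is denoted ũ_{k+1}, and for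
b ∈ Λ̄₅^{(k)*} it is given by ũ_{k+1} = (Q^{s*}_{k+1}v) exp ie_kη[(1 − θ_k)H_{k,loc}A^{(k)} − L^{−2}𝒟^η_{k+1,loc}∂*Q^{e*}_{k+1}f]. (5.6.1)"*
(`Q = Q^{s*}_{k+1}v`). [cite: BalabanImbrieJaffe1988, (5.6.1) p.285] -/
def uTilde561 {B : Type*} (ek η L : ℝ) (Q : B → ℂ) (θ HA DXf : B → ℝ) : B → ℂ :=
  bgExp ek η Q (bracket561 L θ HA DXf)

/-- kernel, p. 286 [PDF 30], verbatim: *"In Λ̄₆^{(k)*} the A^{(k)} term is absent, and except for scaling, this reduces to the form in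
the induction hypothesis, (4.2)."* — where `θ_k(b) = 1`, `ũ_{k+1}(b) = (Q^{s*}_{k+1}v)(b) exp(−ie_kη L^{−2}(𝒟^η_{k+1,loc}∂*Q^{e*}_{k+1}f)(b))`, i.e.
`BIJ88Sect4Statements.backgroundU` with `g = L^{−2}𝒟∂*Q^{e*}f`. [cite: BalabanImbrieJaffe1988, (5.6.1) p.286] -/
theorem uTilde561_of_theta_eq_one {B : Type*} (ek η L : ℝ) (Q : B → ℂ) {θ : B → ℝ} (HA DXf : B → ℝ) {b : B}
    (hθ : θ b = 1) :
    uTilde561 ek η L Q θ HA DXf b = backgroundU ek η Q (fun b => L⁻¹ ^ 2 * DXf b) b := by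
  simp only [uTilde561, bgExp, bracket561, backgroundU, hθ, sub_self, zero_mul, zero_sub]
  congr 1
  push_cast
  ring_nf

/-- kernel: multiplying the exponential form by a phase `exp ie_kη[Y]` ADDS `Y` to the bracket — the mechanism of (5.6.6)
`ũ_{k+1}ũ = ũ_{k+1} exp ie_kη[θ_kH_{k,loc}A^{(k)} + w₁A′] = ũ_{k+1}e^{ie_kηÃ}` and of (5.7.1) `u_{k+1}ũ̃`, `ũ̃ = exp ie_kη[θ_kH_{k,loc}A^{(k)} + w₅A′]`.
[cite: BalabanImbrieJaffe1988, (5.6.6) p.287] -/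
theorem bgExp_mul_phase {B : Type*} (ek η : ℝ) (Q : B → ℂ) (X Y : B → ℝ) (b : B) :
    bgExp ek η Q X b * exp (I * (ek * η * Y b : ℝ)) = bgExp ek η Q (fun b => X b + Y b) b := by
  simp only [bgExp]
  rw [mul_assoc, ← Complex.exp_add]
  congr 2
  push_cast
  ring

/-- **(5.6.6)** p. 287 [PDF 31] / **(5.7.1)** p. 289 [PDF 33], verbatim: *"… and write the background field as ũ_{k+1}ũ = ũ_{k+1} exp ie_kη
[θ_kH_{k,loc}A^{(k)} + w₁A′] = ũ_{k+1}e^{ie_kηÃ}. (5.6.6)"*; *"We express it as u_{k+1}ũ̃, with ũ̃ = exp ie_kη[θ_kH_{k,loc}A^{(k)} + w₅A′] ≡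
exp ie_kηÃ̃. (5.7.1)"* — the small multiplicative field, pointwise (`wA = w₁A′` resp. `w₅A′`).
[cite: BalabanImbrieJaffe1988, (5.6.6) p.287] -/
def uSmall566 {B : Type*} (ek η : ℝ) (θ HA wA : B → ℝ) : B → ℂ :=
  fun b => exp (I * (ek * η * (θ b * HA b + wA b) : ℝ))

/-- kernel: **(5.6.6) recovers (5.5.14)** — `ũ_{k+1}ũ = (Q^{s*}_{k+1}v) exp ie_kη[H_{k,loc}A^{(k)} − L^{−2}𝒟^η_{k+1,loc}∂*Q^{e*}_{k+1}f + w₁A′] =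
u′_k` on `Λ̄₅^{(k)*}` (where (5.6.1) holds), since `(1 − θ_k)H_{k,loc}A^{(k)} + θ_kH_{k,loc}A^{(k)} = H_{k,loc}A^{(k)}`; the same computation
with `w₅` gives (5.7.1) against the normalization-factor field of p. 285. [cite: BalabanImbrieJaffe1988, (5.6.6) p.287] -/
theorem eq566 {B : Type*} (ek η L : ℝ) (Q : B → ℂ) (θ HA DXf wA : B → ℝ) (b : B) :
    uTilde561 ek η L Q θ HA DXf b * uSmall566 ek η θ HA wA b
      = bgExp ek η Q (fun b => HA b - L⁻¹ ^ 2 * DXf b + wA b) b := by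
  simp only [uTilde561, uSmall566, bgExp, bracket561]
  rw [mul_assoc, ← Complex.exp_add]
  congr 2
  push_cast
  ring

end

section Transl552Repaired

variable {M : Type*} [AddCommGroup M] [Module ℝ M]

/-- **(5.5.2) with the cut-off inside the localized covariance** (reading (a) of HOME/GAPS.md G-C2-08, owner ruling r16 g4): for
`A″ = A^{(k)} − L^{−2}C^{(k)}_{loc}Λ₄^{(k)*}H*_{k,loc}∂*Q^{e*}_{k+1}f` the printed sentence p. 284 l.1–2 *"Our construction of a
C^{(k)}_{loc} satisfying (2.10), (2.11) ensures that … δ(QA′) = δ(QA^{(k)})"* holds by (2.10) `QC^{(k)}_{loc} = 0` alone: `QA″ = QA^{(k)}`.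
(For the printed operator order see the reading note on `Q_transl552`; concrete-kernel form of the present statement:
`BIJ88Eq552CutoffWitness.qKer_mul_clocKer_mul`.) [cite: BalabanImbrieJaffe1988, (5.5.2) p.283] -/
theorem Q_transl552_inside (L : ℝ) {Q Cloc : Module.End ℝ M} (hQ : Q * Cloc = 0) (Λ4 Hsloc X : Module.End ℝ M) (A f : M) :
    Q (A - L⁻¹ ^ 2 • Cloc (Λ4 (Hsloc (X f)))) = Q A := by
  have h0 : Q (Cloc (Λ4 (Hsloc (X f)))) = 0 := by
    have := congrArg (fun T : Module.End ℝ M => T (Λ4 (Hsloc (X f)))) hQ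
    simpa [Module.End.mul_apply] using this
  simp [map_sub, map_smul, h0]

end Transl552Repaired

end Literature.MathematicalPhysics.QuantumFieldTheory.BalabanImbrieJaffe1984to88.BIJ88Sect5StatementsPart3
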